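import Summits.BirchSwinnertonDyer.BirchSwinnertonDyer.Theorems.AdditiveBranchIMCMultLowerFieldSupplyMTwist
import Summits.BirchSwinnertonDyer.BirchSwinnertonDyer.Theorems.AdditiveBranchIMCGordTwoRankZeroOffCaseOneFieldSupplyR0Local
import Summits.BirchSwinnertonDyer.Rank1Residual.X11b.Three.UpperHalfLocalMult
import Summits.BirchSwinnertonDyer.Rank1Residual.AdditivePotMult.PStarTwistModel
import HarnessLib

/-!
# Route `AdditiveBranchIMC` (rung K1), crux `MultLower` (stmt-BirchSwinnertonDyer-19359), line `tame_roads_mult`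
# v4, stub `stub_fieldSupplyM`: FIELD 2, step 2 — the `p`-RAMIFIED Kolyvagin class for a partner `V`
# MULTIPLICATIVE at `p`, GIVEN the auxiliary twist of root number `−1`

Cell `bsd-addord`, seat `bsd-line-addord-w2`. THEOREMS ONLY. The (M) twin of
`exists_ramifiedClass_partner` (file `…GordTwoRankZeroOffCaseOneFieldSupplyR0Class`): the partner
`V ≅ E^{(p*)}` is now MULTIPLICATIVE at `p`, and the auxiliary data (genus factor `δ₁`, Dirichlet prime `ℓ₀`
with its prescribed symbols — INCLUDING `(δ₁ℓ₀*/p) = −a_p(V)` so that the partner `A` is NON-SPLIT at `p`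
— and the globally minimal `X ≅ V^{(δ₁ℓ₀*)}` with `w(X) = −1` and `p*δ₁ℓ₀* < 0`) are HYPOTHESES: on the
(M) cell the sign `w(X) = −1` is Rohrlich's local sign at the additive place
(`RamifiedHabitat.rootNumber_mul_rootNumber_ramifiedTwist_of_potMult_anyLevel`, which needs the Tate
valuations `v_p(c₄) = 2`, `v_p(Δ) > 6` of the minimal model — the one bridge still to be typed for
`stub_fieldSupplyM`). Output: Friedberg–Hoffstein (prescribed splitting) on `X` ⟹ `d`; `d'' = p*q*ℓ₀*d < 0`
fundamental; `K'' = ℚ(√d'')` imaginary; the globally minimal `A ≅ X^{(d)} ≅ Wd^{(d'')} ≅ E^{(u)}`,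
`u = p*δ₁ℓ₀*d`, of analytic rank `0`, MULTIPLICATIVE and NON-SPLIT at `p`
(`X11b.Three.split_twist_iff_not_split_of_jacobiSym` / `hasSplitMultiplicativeReductionAtPrime_quadraticTwist_iff`),
`ρ̄_{A,p}` onto, with the splitting / ramification bookkeeping of `K''` and the Jacobi data of `u` at the bad
primes `≠ p` of `E` (for the local analysis of step 3).

References: [FriedbergHoffstein1995] Thm. B; [JetchevSkinnerWan2017] §7.4.1; [SilvermanAEC2009] X.5.4, VII.5.1.
-/

set_option linter.dupNamespace false

noncomputable section

open scoped Classical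

open WeierstrassCurve NumberField IsDedekindDomain
  Literature.NumberTheory.EllipticCurves
  Literature.NumberTheory.EllipticCurves.ModularForms
  Literature.NumberTheory.EllipticCurves.Rank1Residual
  Literature.NumberTheory.QuadraticFields
  Summit.BirchSwinnertonDyer.Rank1Residual
  Summit.BirchSwinnertonDyer.Rank1Residual.Additive

namespace Summit.BirchSwinnertonDyer.BirchSwinnertonDyer.Theorems.ThreeFieldRoadSupply

open NumberTheorySymbols
open Summit.BirchSwinnertonDyer.BirchSwinnertonDyer.Theorems.AdditiveKoly.RamifiedHabitat (pStar_emod_four eq_of_prime_dvd_pStar)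

section Class

variable (W : WeierstrassCurve ℚ) [W.IsElliptic] [W.IsGloballyMinimal] (p : ℕ) [hp : Fact p.Prime]
  {q : ℕ} [hq : Fact q.Prime] (K : Type) [Field K] [NumberField K]
  {Wd : WeierstrassCurve ℚ} [Wd.IsElliptic] [Wd.IsGloballyMinimal]

omit [W.IsGloballyMinimal] [Wd.IsGloballyMinimal] in
/-- **FIELD 2 on the (M) cell — the `p`-ramified Kolyvagin class and its rank-zero partner `A`, MULTIPLICATIVE
and NON-SPLIT at `p`** (see the module docstring for the construction; the auxiliary twist is a hypothesis).
[cite: FriedbergHoffstein1995, Thm. B (1), as applied in JetchevSkinnerWan2017 §7.4.1]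
[cite: SilvermanAEC2009, X.5 Cor. 5.4 and VII.5 Prop. 5.1] -/
theorem exists_ramifiedClass_partner_mult
    (hFH : friedbergHoffstein_exists_heegnerField_splitDivisors_twist_ne_zero)
    (hL : hasEntireLFunction_rat)
    (hp5 : 5 ≤ p) (hsurj : Surj W p) (hqp : q ≠ p) (hq2 : q ≠ 2)
    (hK : IsImaginaryQuadratic K) (h2K : ((Ideal.span {(2 : ℤ)}).primesOver (𝓞 K)).ncard = 2)
    (Cd : VariableChange ℚ) (hWd : Cd • W.quadraticTwist (NumberField.discr K : ℚ) = Wd)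
    -- the multiplicative partner and the auxiliary data (hypotheses on the (M) cell)
    (V : WeierstrassCurve ℚ) [V.IsElliptic] [V.IsGloballyMinimal] (C' : VariableChange ℚ)
    (hC' : C' • V.quadraticTwist ((-1 : ℚ) ^ (p / 2) * p) = W)
    (hmultV : V.HasMultiplicativeReductionAtPrime p)
    {δ : ℤ} (hfac : NumberField.discr K = ((-1 : ℤ) ^ (q / 2) * q) * δ) (hδsq : Squarefree δ)
    (hpδ : ¬ (p : ℤ) ∣ δ)
    {ℓ₀ : ℕ} (hℓ₀ : ℓ₀.Prime) (hℓ₀p : ℓ₀ ≠ p) (hℓ₀q : ℓ₀ ≠ q)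
    (hℓ₀M : ¬ ℓ₀ ∣ W.conductorNorm ℤ * Wd.conductorNorm ℤ) (hℓ₀δ : ¬ (ℓ₀ : ℤ) ∣ δ)
    (h8ℓ₀ : (((-1 : ℤ) ^ (p / 2) * p) * ((-1 : ℤ) ^ (q / 2) * q) * ((-1 : ℤ) ^ (ℓ₀ / 2) * ℓ₀)) % 8 = 1)
    (hJsplit : ∀ ℓ : ℕ, ℓ.Prime → ℓ ∣ W.conductorNorm ℤ * Wd.conductorNorm ℤ → ℓ ≠ 2 → ℓ ≠ p → ℓ ≠ q →
      J((-1 : ℤ) ^ (ℓ₀ / 2) * ℓ₀ | ℓ) = J(((-1 : ℤ) ^ (p / 2) * p) * ((-1 : ℤ) ^ (q / 2) * q) | ℓ))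
    (hJq : J((-1 : ℤ) ^ (ℓ₀ / 2) * ℓ₀ | q) = J(((-1 : ℤ) ^ (p / 2) * p) * δ | q))
    (hJp : J(δ * ((-1 : ℤ) ^ (ℓ₀ / 2) * ℓ₀) | p) =
      if V.HasSplitMultiplicativeReductionAtPrime p then -1 else 1)
    (hT4 : (δ * ((-1 : ℤ) ^ (ℓ₀ / 2) * ℓ₀)) % 4 = 1)
    (hneg : ((-1 : ℤ) ^ (p / 2) * p) * (δ * ((-1 : ℤ) ^ (ℓ₀ / 2) * ℓ₀)) < 0)
    (hb : ∀ ℓ : ℕ, ℓ.Prime → ℓ ∣ W.conductorNorm ℤ → ℓ ≠ p → ℓ ≠ 2 →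
      J(((-1 : ℤ) ^ (p / 2) * p) * (δ * ((-1 : ℤ) ^ (ℓ₀ / 2) * ℓ₀)) | ℓ) = 1)
    (h8 : 2 ∣ W.conductorNorm ℤ → (((-1 : ℤ) ^ (p / 2) * p) * (δ * ((-1 : ℤ) ^ (ℓ₀ / 2) * ℓ₀))) % 8 = 1)
    {X : WeierstrassCurve ℚ} [X.IsElliptic] [X.IsGloballyMinimal] (CX : VariableChange ℚ)
    (hCX : CX • X = V.quadraticTwist ((δ * ((-1 : ℤ) ^ (ℓ₀ / 2) * ℓ₀) : ℤ) : ℚ))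
    (hXroot : X.rootNumber = -1) :
    ∃ (T d : ℤ) (K'' : Type) (_ : Field K'') (_ : NumberField K'')
      (A : WeierstrassCurve ℚ) (_ : A.IsElliptic) (_ : A.IsGloballyMinimal),
      T = δ * ((-1 : ℤ) ^ (ℓ₀ / 2) * ℓ₀) ∧
      NumberField.discr K'' =
        ((-1 : ℤ) ^ (p / 2) * p) * ((-1 : ℤ) ^ (q / 2) * q) * ((-1 : ℤ) ^ (ℓ₀ / 2) * ℓ₀) * d ∧
      IsImaginaryQuadratic K'' ∧
      (∀ ℓ : ℕ, ℓ.Prime → ℓ ∣ W.conductorNorm ℤ * Wd.conductorNorm ℤ → ℓ ≠ p → ℓ ≠ q →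
        SatisfiesHeegnerHypothesis ℓ K'') ∧
      (∀ ℓ : ℕ, ℓ.Prime → (ℓ : ℤ) ∣ NumberField.discr K'' →
        ℓ ∣ W.conductorNorm ℤ * Wd.conductorNorm ℤ → ℓ = p ∨ ℓ = q) ∧
      (∃ C : VariableChange ℚ, C • Wd.quadraticTwist (NumberField.discr K'' : ℚ) = A) ∧
      (∃ C : VariableChange ℚ, C • W.quadraticTwist ((((-1 : ℤ) ^ (p / 2) * p) * T * d : ℤ) : ℚ) = A) ∧
      (((-1 : ℤ) ^ (p / 2) * p) * T * d) % 4 = 1 ∧ Squarefree (((-1 : ℤ) ^ (p / 2) * p) * T * d) ∧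
      (∀ ℓ : ℕ, ℓ.Prime → ℓ ∣ W.conductorNorm ℤ → ℓ ≠ p →
        (ℓ = 2 → (((-1 : ℤ) ^ (p / 2) * p) * T * d) % 8 = 1) ∧
        (ℓ ≠ 2 → J(((-1 : ℤ) ^ (p / 2) * p) * T * d | ℓ) = 1)) ∧
      A.analyticRank = 0 ∧
      (A.HasMultiplicativeReductionAtPrime p ∧ ¬ A.HasSplitMultiplicativeReductionAtPrime p) ∧
      Surj A p := by
  have hp2 : p ≠ 2 := by omega
  have hpq : p ≠ q := fun h ↦ hqp h.symm
  have hδ0 : δ ≠ 0 := by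
    rintro rfl; rw [mul_zero] at hfac; exact (NumberField.discr_ne_zero K) hfac
  -- notation
  set ps : ℤ := (-1 : ℤ) ^ (p / 2) * p with hps
  set qs : ℤ := (-1 : ℤ) ^ (q / 2) * q with hqs
  set ls : ℤ := (-1 : ℤ) ^ (ℓ₀ / 2) * ℓ₀ with hls
  set T : ℤ := δ * ls with hT
  set dK : ℤ := NumberField.discr K with hdK
  clear_value dK
  have hdK0 : dK ≠ 0 := by rw [hdK]; exact NumberField.discr_ne_zero K
  have hdKneg : dK < 0 := by rw [hdK]; exact hK.discr_neg
  have hd8K : dK % 8 = 1 := by rw [hdK]; exact (discr_emod_eight_of_two_split K hK h2K).1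
  have hNW0 : W.conductorNorm ℤ ≠ 0 := (W.conductorNorm_pos_holds).ne'
  have hNWd0 : Wd.conductorNorm ℤ ≠ 0 := (Wd.conductorNorm_pos_holds).ne'
  set M : ℕ := W.conductorNorm ℤ * Wd.conductorNorm ℤ with hM
  have hM0 : M ≠ 0 := mul_ne_zero hNW0 hNWd0
  have hℓ₀2 : ℓ₀ ≠ 2 := by
    rintro rfl
    have := h8ℓ₀
    omega
  have hls4 : ls % 4 = 1 := (haveI := Fact.mk hℓ₀; pStar_emod_four (p := ℓ₀) hℓ₀2)
  have hps4 : ps % 4 = 1 := pStar_emod_four (p := p) hp2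
  have hqs4 : qs % 4 = 1 := pStar_emod_four (p := q) hq2
  have hT0 : T ≠ 0 := by rintro h; rw [h] at hT4; norm_num at hT4
  have hTq : (T : ℚ) ≠ 0 := by exact_mod_cast hT0
  haveI := V.isElliptic_quadraticTwist hTq
  -- §e Friedberg–Hoffstein on `X`
  set SFH : Finset ℕ := (2 * p * q * ℓ₀ * M * dK.natAbs).primeFactors with hSFH
  have hSFH0 : 2 * p * q * ℓ₀ * M * dK.natAbs ≠ 0 := by
    refine mul_ne_zero (mul_ne_zero (mul_ne_zero (mul_ne_zero (mul_ne_zero two_ne_zero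
      hp.out.ne_zero) hq.out.ne_zero) hℓ₀.ne_zero) hM0) (Int.natAbs_ne_zero.mpr hdK0)
  have hSFH_mem : ∀ ℓ : ℕ, ℓ.Prime → ℓ ∣ 2 * p * q * ℓ₀ * M * dK.natAbs → ℓ ∈ SFH := fun ℓ hℓ hd ↦
    Nat.mem_primeFactors.mpr ⟨hℓ, hd, hSFH0⟩
  obtain ⟨d, hdneg, hdsq, hd8, -, hdS, hdX, hLd⟩ :=
    exists_neg_fundamental_twist_ne_zero_of_friedbergHoffstein hFH X hXroot SFH 0
  have hd0 : d ≠ 0 := hdneg.ne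
  have hdq0 : (d : ℚ) ≠ 0 := by exact_mod_cast hd0
  have hd4 : d % 4 = 1 := by omega
  -- `(d/ℓ) = 1`, hence `ℓ ∤ d`, for every odd prime of `2 p q ℓ₀ M d_K`
  have hdJ : ∀ ℓ : ℕ, ℓ.Prime → ℓ ∣ 2 * p * q * ℓ₀ * M * dK.natAbs → ℓ ≠ 2 → J(d | ℓ) = 1 :=
    fun ℓ hℓ hd h2 ↦ hdS ℓ (hSFH_mem ℓ hℓ hd) hℓ h2
  have hd_ndvd : ∀ ℓ : ℕ, ℓ.Prime → ℓ ∣ 2 * p * q * ℓ₀ * M * dK.natAbs → ¬ (ℓ : ℤ) ∣ d := by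
    intro ℓ hℓ hd
    by_cases h2 : ℓ = 2
    · subst h2; intro h; omega
    · exact not_dvd_of_jacobiSym_eq_one hℓ (hdJ ℓ hℓ hd h2)
  have hpd : ¬ (p : ℤ) ∣ d := hd_ndvd p hp.out ⟨2 * q * ℓ₀ * M * dK.natAbs, by ring⟩
  have hqdd : ¬ (q : ℤ) ∣ d := hd_ndvd q hq.out ⟨2 * p * ℓ₀ * M * dK.natAbs, by ring⟩
  have hℓ₀d : ¬ (ℓ₀ : ℤ) ∣ d := hd_ndvd ℓ₀ hℓ₀ ⟨2 * p * q * M * dK.natAbs, by ring⟩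
  -- §f the partner `A`, a globally minimal model of `X^{(d)}`
  haveI := X.isElliptic_quadraticTwist hdq0
  obtain ⟨A, iA, iAm, CA, hCA⟩ := exists_isGloballyMinimal_smul_eq_quadraticTwist X hdq0
  have hrA : A.analyticRank = 0 := by
    rw [← analyticRank_smul A CA, hCA]
    exact ((X.quadraticTwist (d : ℚ)).analyticRank_eq_zero_iff_holds (hL _)).2 hLd
  -- §g the twist relations
  have hps0' : ps ≠ 0 := by
    rw [hps]; exact mul_ne_zero (pow_ne_zero _ (by norm_num)) (by exact_mod_cast hp.out.ne_zero)
  set u : ℤ := ps * T * d with hu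
  have hAV : ∃ C : VariableChange ℚ, C • A = V.quadraticTwist ((T * d : ℤ) : ℚ) := by
    obtain ⟨C₃, hC₃⟩ : ∃ C₃ : VariableChange ℚ, C₃ = ⟨CX⁻¹.u, (d : ℚ) * CX⁻¹.r, 0, 0⟩ := ⟨_, rfl⟩
    have hX : X = CX⁻¹ • V.quadraticTwist (T : ℚ) := by rw [← hCX, inv_smul_smul]
    have hparam : ((T : ℚ)) * (d : ℚ) = ((T * d : ℤ) : ℚ) := by push_cast; ring
    have e1 : X.quadraticTwist (d : ℚ) = C₃ • V.quadraticTwist ((T * d : ℤ) : ℚ) := by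
      rw [hX, WeierstrassCurve.quadraticTwist_smul, quadraticTwist_quadraticTwist, ← hC₃, hparam]
    refine ⟨C₃⁻¹ * CA, ?_⟩
    rw [mul_smul, hCA, e1, inv_smul_smul]
  have hAW : ∃ C : VariableChange ℚ, C • W.quadraticTwist ((u : ℤ) : ℚ) = A := by
    obtain ⟨C₁, hC₁⟩ := hAV
    -- `W^{(u)} ≅ V^{(ps u)} = V^{(T d ps²)} ≅ V^{(T d)} ≅ A`
    obtain ⟨C'', hC''⟩ : ∃ C'' : VariableChange ℚ, C'' = ⟨C'.u, ((u : ℤ) : ℚ) * C'.r, 0, 0⟩ :=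
      ⟨_, rfl⟩
    have hparam : ((-1 : ℚ) ^ (p / 2) * (p : ℚ)) * ((u : ℤ) : ℚ) =
        ((T * d : ℤ) : ℚ) * ((ps : ℤ) : ℚ) ^ 2 := by
      rw [hu, hps]; push_cast; ring
    have e1 : W.quadraticTwist ((u : ℤ) : ℚ) =
        C'' • V.quadraticTwist (((T * d : ℤ) : ℚ) * ((ps : ℤ) : ℚ) ^ 2) := by
      rw [← hC', WeierstrassCurve.quadraticTwist_smul, quadraticTwist_quadraticTwist, ← hC'', hparam]
    have hps0 : ((ps : ℤ) : ℚ) ≠ 0 := by exact_mod_cast hps0'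
    obtain ⟨C₂, hC₂⟩ := V.exists_variableChange_quadraticTwist_mul_sq (((T * d : ℤ) : ℚ)) _ hps0
    have e2 : W.quadraticTwist ((u : ℤ) : ℚ) = (C'' * C₂ * C₁) • A := by
      rw [e1, ← hC₂, ← hC₁, mul_smul, mul_smul]
    exact ⟨(C'' * C₂ * C₁)⁻¹, by rw [e2, inv_smul_smul]⟩
  -- §h the discriminant `d'' = p* q* ℓ₀* d` and the field `K''`
  set D : ℤ := ps * qs * ls * d with hD
  have hpsqsls_pos : 0 < ps * qs * ls := by
    -- `(ps qs ls) δ² = (ps δ ls)(qs δ) = (ps T)(d_K) > 0`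
    have hqsδ : qs * δ < 0 := by rw [← hfac]; exact hdKneg
    have h1' : 0 < (ps * T) * (qs * δ) := mul_pos_of_neg_of_neg hneg hqsδ
    have e : (ps * T) * (qs * δ) = (ps * qs * ls) * (δ * δ) := by rw [hT]; ring
    rw [e] at h1'
    have hδ2 : 0 < δ * δ := mul_self_pos.mpr hδ0
    exact (pos_iff_pos_of_mul_pos h1').mpr hδ2
  have hDneg : D < 0 := by rw [hD]; exact mul_neg_of_pos_of_neg hpsqsls_pos hdneg
  have hD4 : D % 4 = 1 := by
    rw [hD, Int.mul_emod, show (ps * qs * ls) % 4 = 1 by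
      rw [Int.mul_emod, show (ps * qs) % 4 = 1 by rw [Int.mul_emod, hps4, hqs4]; decide, hls4]; decide,
      hd4]; decide
  have hD8 : D % 8 = 1 := by
    rw [hD, Int.mul_emod, h8ℓ₀, hd8]; decide
  have hDsq : Squarefree D := by
    -- `|D| = p q ℓ₀ |d|` with `p, q, ℓ₀` distinct primes not dividing the square-free `d`
    rw [← Int.squarefree_natAbs]
    have hDabs : D.natAbs = p * q * ℓ₀ * d.natAbs := by
      rw [hD, Int.natAbs_mul, Int.natAbs_mul, Int.natAbs_mul, hps, hqs, hls, natAbs_pStar,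
        natAbs_pStar, natAbs_pStar (p := ℓ₀)]
    rw [hDabs]
    have hcop1 : Nat.Coprime (p * q * ℓ₀) d.natAbs := by
      refine Nat.Coprime.mul_left (Nat.Coprime.mul_left ?_ ?_) ?_
      · exact (Nat.Prime.coprime_iff_not_dvd hp.out).mpr fun h ↦
          hpd (Int.natAbs_dvd_natAbs.mp (by simpa using h))
      · exact (Nat.Prime.coprime_iff_not_dvd hq.out).mpr fun h ↦
          hqdd (Int.natAbs_dvd_natAbs.mp (by simpa using h))
      · exact (Nat.Prime.coprime_iff_not_dvd hℓ₀).mpr fun h ↦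
          hℓ₀d (Int.natAbs_dvd_natAbs.mp (by simpa using h))
    rw [Nat.squarefree_mul hcop1]
    refine ⟨?_, Int.squarefree_natAbs.mpr hdsq⟩
    have hcop2 : Nat.Coprime (p * q) ℓ₀ :=
      Nat.Coprime.mul_left ((Nat.coprime_primes hp.out hℓ₀).mpr (Ne.symm hℓ₀p))
        ((Nat.coprime_primes hq.out hℓ₀).mpr (Ne.symm hℓ₀q))
    rw [Nat.squarefree_mul hcop2]
    refine ⟨?_, hℓ₀.prime.squarefree⟩
    rw [Nat.squarefree_mul ((Nat.coprime_primes hp.out hq.out).mpr hpq)]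
    exact ⟨hp.out.prime.squarefree, hq.out.prime.squarefree⟩
  obtain ⟨K'', iF'', iN'', h2'', hdisc''⟩ :=
    Quadratic.exists_numberField_discr_eq (D := D) (Or.inl ⟨hD4, hDsq, by omega⟩)
  have hK'' : IsImaginaryQuadratic K'' := isImaginaryQuadratic_of_discr_eq_of_neg h2'' hdisc'' hDneg
  -- §i `A ≅ Wd^{(d'')}`: `d_K · D = qs² · u`
  have hAWd : ∃ C : VariableChange ℚ, C • Wd.quadraticTwist (NumberField.discr K'' : ℚ) = A := by
    obtain ⟨C₁, hC₁⟩ := hAW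
    obtain ⟨C₄, hC₄⟩ : ∃ C₄ : VariableChange ℚ, C₄ = ⟨Cd.u, ((D : ℤ) : ℚ) * Cd.r, 0, 0⟩ := ⟨_, rfl⟩
    have hparam : ((dK : ℤ) : ℚ) * ((D : ℤ) : ℚ) = ((u : ℤ) : ℚ) * ((qs : ℤ) : ℚ) ^ 2 := by
      have hdKfac : dK = qs * δ := hfac
      rw [hdKfac, hD, hu, hT]; push_cast; ring
    have e1 : Wd.quadraticTwist ((D : ℤ) : ℚ) =
        C₄ • W.quadraticTwist (((u : ℤ) : ℚ) * ((qs : ℤ) : ℚ) ^ 2) := by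
      rw [← hWd, WeierstrassCurve.quadraticTwist_smul, quadraticTwist_quadraticTwist, ← hC₄, hparam]
    have hqs0' : qs ≠ 0 := by
      rw [hqs]; exact mul_ne_zero (pow_ne_zero _ (by norm_num)) (by exact_mod_cast hq.out.ne_zero)
    have hqs0 : ((qs : ℤ) : ℚ) ≠ 0 := by exact_mod_cast hqs0'
    obtain ⟨C₂, hC₂⟩ := W.exists_variableChange_quadraticTwist_mul_sq (((u : ℤ) : ℚ)) _ hqs0
    have hWu : W.quadraticTwist ((u : ℤ) : ℚ) = C₁⁻¹ • A := by rw [← hC₁, inv_smul_smul]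
    have e2 : Wd.quadraticTwist ((D : ℤ) : ℚ) = (C₄ * C₂ * C₁⁻¹) • A := by
      rw [e1, ← hC₂, hWu, smul_smul, smul_smul]
    refine ⟨(C₄ * C₂ * C₁⁻¹)⁻¹, ?_⟩
    rw [hdisc'', e2, inv_smul_smul]
  -- §j the reduction of `A` at `p`; surjectivity at `p`
  have hTd_sq : Squarefree (T * d) := by
    rw [squarefree_mul_iff]
    refine ⟨?_, ?_, hdsq⟩
    · refine (Int.isCoprime_iff_gcd_eq_one.mpr ?_).isRelPrime
      rw [Int.gcd_eq_natAbs]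
      refine Nat.coprime_of_dvd fun ℓ hℓ hℓT hℓd ↦ hd_ndvd ℓ hℓ ?_ (Int.natAbs_dvd_natAbs.mp (by simpa using hℓd))
      have hℓT' : (ℓ : ℤ) ∣ T := Int.natAbs_dvd_natAbs.mp (by simpa using hℓT)
      rw [hT] at hℓT'
      rcases Int.Prime.dvd_mul' hℓ hℓT' with h | h
      · -- `ℓ ∣ δ ∣ d_K`
        have hℓdK : ℓ ∣ dK.natAbs := by
          have := h.trans (⟨qs, by rw [mul_comm]; exact hfac⟩ : δ ∣ dK)
          simpa using Int.natAbs_dvd_natAbs.mpr this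
        exact hℓdK.mul_left _
      · have h' : ℓ ∣ ls.natAbs := by simpa using Int.natAbs_dvd_natAbs.mpr h
        rw [hls, natAbs_pStar] at h'
        rw [(Nat.prime_dvd_prime_iff_eq hℓ hℓ₀).mp h']
        exact ⟨2 * p * q * M * dK.natAbs, by ring⟩
    · rw [hT, squarefree_mul_iff]
      refine ⟨?_, hδsq, ?_⟩
      · refine (Int.isCoprime_iff_gcd_eq_one.mpr ?_).isRelPrime
        rw [Int.gcd_eq_natAbs, hls, natAbs_pStar]
        exact Nat.Coprime.symm ((Nat.Prime.coprime_iff_not_dvd hℓ₀).mpr fun h ↦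
          hℓ₀δ (Int.natAbs_dvd_natAbs.mp (by simpa using h)))
      · rw [hls]; exact (haveI := Fact.mk hℓ₀; squarefree_pStar (p := ℓ₀))
  have hpTd : ¬ (p : ℤ) ∣ T * d := by
    intro h
    rcases Int.Prime.dvd_mul' hp.out h with h | h
    · rw [hT] at h
      rcases Int.Prime.dvd_mul' hp.out h with h | h
      · exact hpδ h
      · have h' : p ∣ ls.natAbs := by simpa using Int.natAbs_dvd_natAbs.mpr h
        rw [hls, natAbs_pStar] at h'
        exact hℓ₀p ((Nat.prime_dvd_prime_iff_eq hp.out hℓ₀).mp h').symm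
    · exact hpd h
  -- multiplicative and NON-SPLIT at `p`
  have hTd4 : (T * d) % 4 = 1 := by rw [Int.mul_emod, hT4, hd4]; decide
  have hTd0 : T * d ≠ 0 := mul_ne_zero hT0 hd0
  have hTdq : ((T * d : ℤ) : ℚ) ≠ 0 := by exact_mod_cast hTd0
  have hTd1 : T * d ≠ 1 := by
    intro h
    rcases Int.eq_one_or_neg_one_of_mul_eq_one h with hT1 | hT1
    · rw [hT1, one_mul] at h; rw [h] at hdneg; norm_num at hdneg
    · rw [hT1] at hT4; norm_num at hT4
  have hJdp : J(d | p) = 1 := hdJ p hp.out ⟨2 * q * ℓ₀ * M * dK.natAbs, by ring⟩ hp2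
  have hJTdp : J(T * d | p) = (if V.HasSplitMultiplicativeReductionAtPrime p then -1 else 1) := by
    rw [jacobiSym.mul_left, hJdp, mul_one]; exact hJp
  obtain ⟨C₁, hC₁⟩ := hAV
  have hCu : C₁⁻¹ • V.quadraticTwist ((T * d : ℤ) : ℚ) = A := by rw [← hC₁, inv_smul_smul]
  have hval : padicValRat p ((T * d : ℤ) : ℚ) = 0 := by
    rw [padicValRat.of_int]; exact_mod_cast padicValInt.eq_zero_of_not_dvd hpTd
  have hmA : A.HasMultiplicativeReductionAtPrime p :=
    AdditivePotMult.mult_of_model_unit_twist hp2 hTdq hval hmultV ⟨C₁⁻¹, hCu⟩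
  have hnsA : ¬ A.HasSplitMultiplicativeReductionAtPrime p := by
    by_cases hsV : V.HasSplitMultiplicativeReductionAtPrime p
    · -- `(Td/p) = −1`: the unit twist flips split-ness
      rw [if_pos hsV] at hJTdp
      obtain ⟨K₃, iF₃, iN₃, h2₃, hdisc₃⟩ :=
        Quadratic.exists_numberField_discr_eq (D := T * d) (Or.inl ⟨hTd4, hTd_sq, hTd1⟩)
      have hJ₃ : jacobiSym (NumberField.discr K₃) p = -1 := by rw [hdisc₃]; exact hJTdp
      have hCu' : C₁⁻¹ • V.quadraticTwist (NumberField.discr K₃ : ℚ) = A := by rw [hdisc₃]; exact hCu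
      rw [X11b.Three.split_twist_iff_not_split_of_jacobiSym V K₃ C₁⁻¹ hCu' p hp2 hJ₃ hmultV, not_not]
      exact hsV
    · -- `(Td/p) = +1`: the twist is by a square of `ℚ_p`
      rw [if_neg hsV] at hJTdp
      haveI := V.isElliptic_quadraticTwist hTdq
      have hsq : IsSquare (((T * d : ℤ) : ℚ) : ℚ_[p]) :=
        isSquare_padic_of_fundamental hTd4 hTd_sq hTd1 ⟨fun h ↦ (hp2 h).elim, fun _ ↦ hJTdp⟩
      rw [← hCu, hasSplitMultiplicativeReductionAtPrime_smul_iff,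
        hasSplitMultiplicativeReductionAtPrime_quadraticTwist_iff V hTdq (by simpa using hsq)]
      exact hsV
  have hu0 : u ≠ 0 := by rw [hu]; exact mul_ne_zero (mul_ne_zero hps0' hT0) hd0
  have huq : ((u : ℤ) : ℚ) ≠ 0 := by exact_mod_cast hu0
  have hsurjA : Surj A p := (Additive.surj_iff_of_model_twist W p huq hAW).mpr hsurj
  -- §k arithmetic of `u = p* T d`
  have hu4 : u % 4 = 1 := by
    rw [hu, Int.mul_emod, show (ps * T) % 4 = 1 by rw [Int.mul_emod, hps4, hT4]; decide, hd4]; decide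
  have husq : Squarefree u := by
    rw [hu, mul_assoc, squarefree_mul_iff]
    refine ⟨?_, squarefree_pStar, hTd_sq⟩
    refine (Int.isCoprime_iff_gcd_eq_one.mpr ?_).isRelPrime
    rw [Int.gcd_eq_natAbs, hps, natAbs_pStar]
    exact (Nat.Prime.coprime_iff_not_dvd hp.out).mpr fun h ↦
      hpTd (Int.natAbs_dvd_natAbs.mp (by simpa using h))
  have hJu : ∀ ℓ : ℕ, ℓ.Prime → ℓ ∣ W.conductorNorm ℤ → ℓ ≠ p →
      (ℓ = 2 → u % 8 = 1) ∧ (ℓ ≠ 2 → J(u | ℓ) = 1) := by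
    intro ℓ hℓ hℓW hℓp
    refine ⟨fun h2 ↦ ?_, fun h2 ↦ ?_⟩
    · subst h2
      rw [hu, Int.mul_emod, h8 hℓW, hd8]; decide
    · rw [hu, jacobiSym.mul_left, hb ℓ hℓ hℓW hℓp h2,
        hdJ ℓ hℓ ((hℓW.mul_right (Wd.conductorNorm ℤ)).trans ⟨2 * p * q * ℓ₀ * dK.natAbs, by rw [hM]; ring⟩) h2]
      norm_num
  -- §l splitting and ramification in `K''`
  have hsplit'' : ∀ ℓ : ℕ, ℓ.Prime → ℓ ∣ M → ℓ ≠ p → ℓ ≠ q → SatisfiesHeegnerHypothesis ℓ K'' := by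
    intro ℓ hℓ hℓM hℓp hℓq
    refine (satisfiesHeegnerHypothesis_iff_kronecker ℓ K'' h2'').mpr fun r hr hrℓ ↦ ?_
    obtain rfl : r = ℓ := (Nat.prime_dvd_prime_iff_eq hr hℓ).mp hrℓ
    rw [hdisc'']
    refine ⟨fun _ ↦ hD8, fun h2 ↦ ?_⟩
    have hJls : J(ls | r) = J(ps * qs | r) := by
      exact hJsplit r hr hℓM h2 hℓp hℓq
    have hJd : J(d | r) = 1 := hdJ r hr (hℓM.trans ⟨2 * p * q * ℓ₀ * dK.natAbs, by ring⟩) h2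
    rw [hD, jacobiSym.mul_left, jacobiSym.mul_left, hJls, hJd, mul_one]
    exact jacobiSym_mul_self_eq_one hr (not_dvd_pStar_mul_pStar (p := p) hr hq.out hℓp hℓq)
  have hram'' : ∀ ℓ : ℕ, ℓ.Prime → (ℓ : ℤ) ∣ NumberField.discr K'' → ℓ ∣ M → ℓ = p ∨ ℓ = q := by
    intro ℓ hℓ hℓD hℓM
    rw [hdisc'', hD] at hℓD
    rcases Int.Prime.dvd_mul' hℓ hℓD with h | h
    · rcases Int.Prime.dvd_mul' hℓ h with h | h
      · rcases Int.Prime.dvd_mul' hℓ h with h | h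
        · exact Or.inl (eq_of_prime_dvd_pStar (p := p) hℓ h)
        · exact Or.inr (eq_of_prime_dvd_pStar (p := q) hℓ h)
      · exact (hℓ₀M ((haveI := Fact.mk hℓ₀; eq_of_prime_dvd_pStar (p := ℓ₀) hℓ h) ▸ hℓM)).elim
    · exact (hd_ndvd ℓ hℓ (hℓM.trans ⟨2 * p * q * ℓ₀ * dK.natAbs, by ring⟩) h).elim
  refine ⟨T, d, K'', iF'', iN'', A, iA, iAm, hT, ?_, hK'', hsplit'', hram'', hAWd, hAW, hu4, husq, hJu, hrA,
    ⟨hmA, hnsA⟩, hsurjA⟩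
  rw [hdisc'', hD]

end Class

end Summit.BirchSwinnertonDyer.BirchSwinnertonDyer.Theorems.ThreeFieldRoadSupply

end
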